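import Summits.NavierStokesRegularity.FluidComputer.GateBudgetNecessity
import Summits.NavierStokesRegularity.FluidComputer.GateBudgetKnobContinuity
import Summits.NavierStokesRegularity.FluidComputer.GateBudgetCarrierPhase
import HarnessLib

/-!
# What no tuning can beat, part 15: EXIT-PHASE SELECTION ACROSS THE KNOB — at clock death the
# transfer mode `d(T;·)` either keeps one strict sign on a knob window or vanishes at some knob;
# a member exiting in PURE INPUT PHASE (`d(T) = 0`) is a dud, and robust firing locks the sign

Cell `pub-fluidc`, blueprint seat bp1 (gen 28); same namespace and conventions as parts 1–14
(`GateBudget*.lean`); imports part 12 (`GateBudgetNecessity`: pulse band, end-game freeze,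
entry law, fired inequality on one trajectory of `rotorCircuit K M ε ρ`), part 13
(`GateBudgetKnobContinuity`: the knob flow `knobFlow K M ε ρ t delayInit`, its continuity in `ρ`,
`knob_phase_selection`) and part 14 (`GateBudgetCarrierPhase`: the transfer-sign law). Modes
`0 = a` input, `1 = b` clock, `2 = c` catalyst (`u = c/ρ²`), `3 = d` transfer, `4 = ã` output;
carrier `E = a² + d²`.
HONEST FRAMING (verbatim): low prior, high value-of-information experiment on Tao's machine
paradigm; NOT a claim that NS blows up. Nothing is proved about the Navier–Stokes equations.

## What this part records (SPEC-INPUT-bp1 §V item (1) = S13″c (ii): exit-phase variation and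
## selection by the intermediate value theorem, with UNIFORM windows at a COMMON entry time `s₀`
## and a COMMON clock-death time `T` over a knob range `[ρlo, ρhi]`, `0 < ρlo`, `ρhi² ≤ ε`)

* §46 FIRED-EXIT LAWS on one trajectory (any exact trajectory from (5.6); `0 < ε ≤ 1`, `0 < ρ`,
  `ρ² ≤ ε`, `0 < M`, `0 ≤ K`, `0 ≤ s₀ ≤ T`, clock dead `b(T) ≤ -β < 0`; ACTION
  `A := 4ε(u(T) + ε)/(Mβ) + 4e^{-M}/M`, BAND `E₋ := e^{-2(2ε+K)(T-s₀)}(1 - 4ε²s₀² - ã(s₀)²)`):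
  exit phase `E(T) ≤ κa(T)²` ⇒ `ã(t)² ≤ 1 - (E₋/κ - A)` for ALL `t ∈ [0, T + β/(2ε)]`
  (`knob_deficit_lower`: part 12's fired inequality + monotone output + energy); fired to
  deficit `δ` in the end-game window ⇒ `a(T)² ≤ δ + A` (`knob_fired_input_small`),
  `d(T)² ≥ E₋ - δ - A` (`knob_fired_transfer_large`), `d(T)² - a(T)² ≥ E₋ - 2(δ + A)`
  (`knob_fired_gap`): A MEMBER THAT FIRES LEAVES THE PULSE IN THE TRANSFER MODE; a member with
  `d(T) = 0` (pure input phase, `κ = 1`) keeps the deficit `≥ E₋(θ₀) - A(λ₀)` on the whole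
  window (`knob_pure_input_dud`; constants monotone in `u(T) ≤ λ₀`, `ã(s₀) ≤ θ₀`).
* §47 LOCK OR DUD (`knob_lock_or_dud`): for the knob flow with uniform windows
  (`∀ ρ ∈ [ρlo, ρhi]`: `b(T;ρ) ≤ -β`, `c(T;ρ) ≤ λ₀ρ²`, `ã(s₀;ρ) ≤ θ₀`) EITHER `d(T;·) > 0` on the
  whole range, OR `d(T;·) < 0` on the whole range, OR some member is a dud:
  `∃ ρ, ∀ t ∈ [0, T + β/(2ε)], ã(t;ρ)² ≤ 1 - (E₋(θ₀) - A(λ₀))` — continuity of `ρ ↦ d(T;ρ)`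
  (part 13) and the intermediate value theorem.
* §48 PHASE LOCK (`knob_phase_lock`): if moreover EVERY member fires to deficit `δ` in the
  common end-game window and `2(δ + A(λ₀)) < E₋(θ₀)`, the dud branch is impossible: the
  transfer mode has ONE strict sign across the range. THE DUD BETWEEN OPPOSITE SIGNS
  (`knob_dud_between`): if `d(T;ρlo)·d(T;ρhi) ≤ 0` a dud exists in `[ρlo, ρhi]`; and the
  anchors are discharged by the members' DOSE PHASES `Φ = (C(T) - C(s₀))/ρ²` through part 14
  (`knob_dud_of_opposite_phases`: `sin Φ·a(s₀)` beyond `±(|d(s₀)| + 2L_T(T - s₀))` with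
  opposite signs at the two anchors, `L_T = ε + ρ²e^{-M} + Kã(T)`).

READING (with part 14 §44: `Φ(T) ≈ π/(σ_knob M)` at clock death, `σ_knob = ρ²/ε`): across a
dyadic window `σ_knob ∈ [σ/2, σ]` the exit phase DOUBLES, so for `σM < 2` it crosses a multiple
of `π` inside the window, the transfer sign changes, and the window CONTAINS A DUD (deficit
`≥ E₋ - A`: essentially nothing transferred when `K(T - s₀) ≪ 1`). Robust firing across a
factor `2` in the knob is impossible below `σ_knob M ≈ 2` for THIS reason alone, independently
of part 12's amplitude inequality; above it (quarter-turn regime) the sign is locked and firing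
is decided by the amplitude laws. That `Φ` DOES double (the arctan swings `Δ ≈ π` uniformly) is
NOT typed here — it is the remaining ingredient S13″c (iii).

TOY (kit j096188, `code/bp1-num/pulse_toy_phaselock.py` + hub-side `reanalyse_windows.py`,
`anchor_check.py`; data `pub-fluidc-bp1/data/g28-toy/`; ε = 10⁻²,
(K,M) ∈ {(10,200),(10,400),(20,400),(40,400)}, 161 knobs per family, 552 dyadic windows read at
the common time `T` = first sample after every member's clock died (`β' ≥ 1.41ε`) and catalyst
decayed (`λ₀ ≤ 10⁻²M`); illustration only): the uniform hypotheses hold in 552/552 windows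
(`θ₀ ≤ 3·10⁻⁷`, `T - s₀ ≤ 0.07`, `E₋ ∈ [0.09, 0.55]`, `A ≤ 0.028`, earliest clock revival
`t = 2.36 >` every window end `≤ 2.20`); the sign of `d(T;·)` changes inside EVERY window with
`σM < 2` (349 windows, flips exactly at `σ_knob M = 1/k`; the 3 windows with `σM = 1.000` sit
with both ends on zeros) and in NO window with `σM ≥ 2.05` (200 windows); `knob_dud_between`'s
anchor hypothesis holds at the window ends in 233 windows and `knob_dud_of_opposite_phases`'
verbatim in 158 (in 263 for some anchor pair inside; never for `K = 40`, `K(T-s₀) ≈ 1.2`);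
in every mixed window the member nearest the sign change has deficit `0.916–0.999` (theorem:
`≥ E₋ - A = 0.069–0.666`); NO window has all its members firing (at most `15` of `25`,
`δ ≤ 0.1`), so the lock theorem's firing hypothesis is never met at toy scale — consistent with
necessity.

HONEST LIMITS. Windows, levels and anchors are HYPOTHESES at the common times `s₀, T` (no
hitting times); "dud" means: not fired to deficit below `E₋(θ₀) - A(λ₀)` at any time
`≤ T + β/(2ε)` — a later second pulse is not excluded here (part 10's no-return law needs its
own window); the band factor `e^{-2(2ε+K)(T-s₀)}` is part 12's crude one (content only for
`K(T - s₀) ≲ 1`, i.e. `M ≫ K`); nothing about the cascade or Navier–Stokes; `0` named facts,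
`0` sorry. [cite: Tao2016AveragedNS, §5.5 Theorem 5.3, (5.5), (5.6), (energy-con);
HairerNorsettWanner1993, Thm I.10.2 (continuous dependence, via part 13)]
-/

noncomputable section

namespace Summit.NavierStokesRegularity.FluidComputer.GateBudget

open Real Set Filter Topology
open Literature.Analysis.FluidPDE.Tao2016AveragedNS

variable {K M ε ρ : ℝ} {X : ℝ → Fin 5 → ℝ}

/-! ## §46 Fired-exit laws on one trajectory -/

/-- **DEFICIT FROM THE EXIT PHASE, whole window.** Exit phase `E(T) ≤ κa(T)²` with the clock dead
at `T` ⇒ `ã(t)² ≤ 1 - (E₋/κ - A)` for every `t ∈ [0, T + β/(2ε)]` (before `T` the output is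
smaller still). [cite: Tao2016AveragedNS, §5.5 Theorem 5.3, (energy-con)] -/
theorem knob_deficit_lower (hX : ∀ t, HasDerivAt X (RotorKnob.rotorCircuit K M ε ρ (X t)) t)
    (h0 : X 0 = delayInit) (hε : 0 < ε) (hε1 : ε ≤ 1) (hρ : 0 < ρ) (hρε : ρ ^ 2 ≤ ε)
    (hM : 0 < M) (hK : 0 ≤ K) {s₀ T β κ : ℝ} (hs₀ : 0 ≤ s₀) (hsT : s₀ ≤ T) (hβ : 0 < β)
    (hbT : X T 1 ≤ -β) (hκ : 0 < κ) (hphase : X T 0 ^ 2 + X T 3 ^ 2 ≤ κ * X T 0 ^ 2) {t : ℝ}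
    (ht : t ∈ Icc 0 (T + β / (2 * ε))) :
    X t 4 ^ 2 ≤ 1 - (exp (-(2 * (2 * ε + K) * (T - s₀))) * (1 - 4 * ε ^ 2 * s₀ ^ 2 - X s₀ 4 ^ 2)
      / κ - 4 * ε * (X T 2 / ρ ^ 2 + ε) / (M * β) - 4 * exp (-M) / M) := by
  have hwin : ∀ t' ∈ Icc T (T + β / (2 * ε)),
      exp (-(2 * (2 * ε + K) * (T - s₀))) * (1 - 4 * ε ^ 2 * s₀ ^ 2 - X s₀ 4 ^ 2) / κ
        - 4 * ε * (X T 2 / ρ ^ 2 + ε) / (M * β) - 4 * exp (-M) / M ≤ X t' 0 ^ 2 := fun t' ht' =>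
    knob_fired_carrier_lower hX h0 hε hε1 hρ hρε hM hK hs₀ hsT le_rfl hβ hbT hκ hphase ht'
  have hsq : ∀ s, X s 4 ^ 2 ≤ 1 - X s 0 ^ 2 := fun s => by
    have := RotorKnob.traj_sum_sq_eq_one hX h0 s
    nlinarith [sq_nonneg (X s 1), sq_nonneg (X s 2), sq_nonneg (X s 3)]
  have hw : (0 : ℝ) < β / (2 * ε) := by positivity
  rcases le_total t T with htT | hTt
  · have hmono : X t 4 ≤ X T 4 := RotorKnob.rotorCircuit_output_monotone hK hX htT
    have h0t : 0 ≤ X t 4 := RotorKnob.e_nonneg hX h0 hK ht.1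
    have hT4 : X t 4 ^ 2 ≤ X T 4 ^ 2 := by nlinarith [mul_self_le_mul_self h0t hmono]
    have hT := hwin T ⟨le_rfl, by linarith⟩
    linarith [hsq T]
  · have ht' := hwin t ⟨hTt, ht.2⟩
    linarith [hsq t]

/-- **FIRED ⇒ INPUT MODE SMALL AT CLOCK DEATH.** Fired to deficit `δ` (`ã(t_f)² ≥ 1 - δ`) at some
`t_f ∈ [T, T + β/(2ε)]` with `b(T) ≤ -β` ⇒ `a(T)² ≤ δ + A` (end-game freeze + energy).
[cite: Tao2016AveragedNS, §5.5 Theorem 5.3, (energy-con)] -/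
theorem knob_fired_input_small (hX : ∀ t, HasDerivAt X (RotorKnob.rotorCircuit K M ε ρ (X t)) t)
    (h0 : X 0 = delayInit) (hε : 0 < ε) (hε1 : ε ≤ 1) (hρ : 0 < ρ) (hρε : ρ ^ 2 ≤ ε)
    (hM : 0 < M) {T β δ t_f : ℝ} (hT : 0 ≤ T) (hβ : 0 < β) (hbT : X T 1 ≤ -β)
    (htf : t_f ∈ Icc T (T + β / (2 * ε))) (hfire : 1 - δ ≤ X t_f 4 ^ 2) :
    X T 0 ^ 2 ≤ δ + 4 * ε * (X T 2 / ρ ^ 2 + ε) / (M * β) + 4 * exp (-M) / M := by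
  have h1 := knob_carrier_freeze_selftimed hX h0 hε hε1 hρ hρε hM hT hβ hbT htf
  have h2 := RotorKnob.traj_sum_sq_eq_one hX h0 t_f
  nlinarith [sq_nonneg (X t_f 1), sq_nonneg (X t_f 2), sq_nonneg (X t_f 3)]

/-- **FIRED ⇒ TRANSFER MODE LARGE AT CLOCK DEATH.** With `0 ≤ s₀ ≤ T` in addition:
`d(T)² ≥ E₋ - δ - A` (pulse band + entry law + `knob_fired_input_small`).
[cite: Tao2016AveragedNS, §5.5 Theorem 5.3, (energy-con)] -/
theorem knob_fired_transfer_large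
    (hX : ∀ t, HasDerivAt X (RotorKnob.rotorCircuit K M ε ρ (X t)) t) (h0 : X 0 = delayInit)
    (hε : 0 < ε) (hε1 : ε ≤ 1) (hρ : 0 < ρ) (hρε : ρ ^ 2 ≤ ε) (hM : 0 < M) (hK : 0 ≤ K)
    {s₀ T β δ t_f : ℝ} (hs₀ : 0 ≤ s₀) (hsT : s₀ ≤ T) (hβ : 0 < β) (hbT : X T 1 ≤ -β)
    (htf : t_f ∈ Icc T (T + β / (2 * ε))) (hfire : 1 - δ ≤ X t_f 4 ^ 2) :
    exp (-(2 * (2 * ε + K) * (T - s₀))) * (1 - 4 * ε ^ 2 * s₀ ^ 2 - X s₀ 4 ^ 2) - δ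
      - 4 * ε * (X T 2 / ρ ^ 2 + ε) / (M * β) - 4 * exp (-M) / M ≤ X T 3 ^ 2 := by
  have ha := knob_fired_input_small hX h0 hε hε1 hρ hρε hM (hs₀.trans hsT) hβ hbT htf hfire
  have hband := knob_carrier_crude_lower hX h0 hε hρε hM.le hK hs₀ hsT
  have hent := knob_carrier_enter hX h0 hε hρε hM.le hs₀
  have hexp := exp_pos (-(2 * (2 * ε + K) * (T - s₀)))
  nlinarith [mul_le_mul_of_nonneg_left hent hexp.le]

/-- **THE FIRED GAP.** Fired ⇒ `d(T)² - a(T)² ≥ E₋ - 2(δ + A)`: a firing member exits the pulse with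
its carrier dominated by the transfer mode. [cite: Tao2016AveragedNS, §5.5 Theorem 5.3] -/
theorem knob_fired_gap (hX : ∀ t, HasDerivAt X (RotorKnob.rotorCircuit K M ε ρ (X t)) t)
    (h0 : X 0 = delayInit) (hε : 0 < ε) (hε1 : ε ≤ 1) (hρ : 0 < ρ) (hρε : ρ ^ 2 ≤ ε)
    (hM : 0 < M) (hK : 0 ≤ K) {s₀ T β δ t_f : ℝ} (hs₀ : 0 ≤ s₀) (hsT : s₀ ≤ T) (hβ : 0 < β)
    (hbT : X T 1 ≤ -β) (htf : t_f ∈ Icc T (T + β / (2 * ε))) (hfire : 1 - δ ≤ X t_f 4 ^ 2) :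
    exp (-(2 * (2 * ε + K) * (T - s₀))) * (1 - 4 * ε ^ 2 * s₀ ^ 2 - X s₀ 4 ^ 2)
      - 2 * (δ + 4 * ε * (X T 2 / ρ ^ 2 + ε) / (M * β) + 4 * exp (-M) / M)
      ≤ X T 3 ^ 2 - X T 0 ^ 2 := by
  have ha := knob_fired_input_small hX h0 hε hε1 hρ hρε hM (hs₀.trans hsT) hβ hbT htf hfire
  have hd := knob_fired_transfer_large hX h0 hε hε1 hρ hρε hM hK hs₀ hsT hβ hbT htf hfire
  linarith

/-- **THE PURE-INPUT-PHASE DUD.** A member whose transfer mode VANISHES at clock death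
(`d(T) = 0`: exit phase `κ = 1`), with `u(T) ≤ λ₀` and `ã(s₀) ≤ θ₀`, keeps
`ã(t)² ≤ 1 - (E₋(θ₀) - A(λ₀))` for all `t ∈ [0, T + β/(2ε)]`.
[cite: Tao2016AveragedNS, §5.5 Theorem 5.3, (energy-con)] -/
theorem knob_pure_input_dud (hX : ∀ t, HasDerivAt X (RotorKnob.rotorCircuit K M ε ρ (X t)) t)
    (h0 : X 0 = delayInit) (hε : 0 < ε) (hε1 : ε ≤ 1) (hρ : 0 < ρ) (hρε : ρ ^ 2 ≤ ε)
    (hM : 0 < M) (hK : 0 ≤ K) {s₀ T β lam₀ θ₀ : ℝ} (hs₀ : 0 ≤ s₀) (hsT : s₀ ≤ T) (hβ : 0 < β)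
    (hbT : X T 1 ≤ -β) (hcT : X T 2 ≤ lam₀ * ρ ^ 2) (heS : X s₀ 4 ≤ θ₀) (hd0 : X T 3 = 0)
    {t : ℝ} (ht : t ∈ Icc 0 (T + β / (2 * ε))) :
    X t 4 ^ 2 ≤ 1 - (exp (-(2 * (2 * ε + K) * (T - s₀))) * (1 - 4 * ε ^ 2 * s₀ ^ 2 - θ₀ ^ 2)
      - 4 * ε * (lam₀ + ε) / (M * β) - 4 * exp (-M) / M) := by
  have hphase : X T 0 ^ 2 + X T 3 ^ 2 ≤ 1 * X T 0 ^ 2 := by rw [hd0]; norm_num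
  have h1 := knob_deficit_lower hX h0 hε hε1 hρ hρε hM hK hs₀ hsT hβ hbT one_pos hphase ht
  have he0 : 0 ≤ X s₀ 4 := RotorKnob.e_nonneg hX h0 hK hs₀
  have hθ : X s₀ 4 ^ 2 ≤ θ₀ ^ 2 := by nlinarith [mul_self_le_mul_self he0 heS]
  have hu : X T 2 / ρ ^ 2 ≤ lam₀ := (div_le_iff₀ (by positivity)).2 hcT
  have hact : 4 * ε * (X T 2 / ρ ^ 2 + ε) / (M * β) ≤ 4 * ε * (lam₀ + ε) / (M * β) := by
    gcongr
  have hE := mul_le_mul_of_nonneg_left (show 1 - 4 * ε ^ 2 * s₀ ^ 2 - θ₀ ^ 2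
      ≤ 1 - 4 * ε ^ 2 * s₀ ^ 2 - X s₀ 4 ^ 2 by linarith)
    (exp_pos (-(2 * (2 * ε + K) * (T - s₀)))).le
  rw [div_one] at h1
  linarith

/-! ## §47 Lock or dud: the transfer mode at clock death across a knob window -/

/-- Knob-range bookkeeping: `ρ ∈ [ρlo, ρhi]`, `0 < ρlo`, `ρhi² ≤ ε` ⇒ `0 < ρ`, `ρ² ≤ ε`.
[folklore] -/
theorem knob_mem_range {ρlo ρhi ρ' ε' : ℝ} (hlo : 0 < ρlo) (hhi : ρhi ^ 2 ≤ ε')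
    (hρ : ρ' ∈ Icc ρlo ρhi) : 0 < ρ' ∧ ρ' ^ 2 ≤ ε' := by
  refine ⟨hlo.trans_le hρ.1, le_trans ?_ hhi⟩
  nlinarith [mul_nonneg (sub_nonneg.2 hρ.2) (show 0 ≤ ρhi + ρ' by linarith [hρ.1, hρ.2]),
    hρ.1, hρ.2]

/-- **LOCK OR DUD.** Knob flow from (5.6) on `[ρlo, ρhi]` (`0 < ρlo`, `ρhi² ≤ ε`, `0 < ε ≤ 1`,
`0 < M`, `0 ≤ K`, `0 ≤ s₀ ≤ T`, `0 < β`) with UNIFORM windows at the common times: clock dead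
`b(T;ρ) ≤ -β`, catalyst spent `c(T;ρ) ≤ λ₀ρ²`, output quiet at entry `ã(s₀;ρ) ≤ θ₀`. Then the
transfer mode at `T` is positive on the whole range, or negative on the whole range, or some
member is a pure-input-phase dud: `ã(t;ρ)² ≤ 1 - (E₋(θ₀) - A(λ₀))` on `[0, T + β/(2ε)]`.
[cite: Tao2016AveragedNS, §5.5 Theorem 5.3; HairerNorsettWanner1993, Thm I.10.2] -/
theorem knob_lock_or_dud {K M ε ρlo ρhi s₀ T β lam₀ θ₀ : ℝ} (hε : 0 < ε) (hε1 : ε ≤ 1)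
    (hM : 0 < M) (hK : 0 ≤ K) (hlo : 0 < ρlo) (hhi : ρhi ^ 2 ≤ ε)
    (hs₀ : 0 ≤ s₀) (hsT : s₀ ≤ T) (hβ : 0 < β)
    (hdead : ∀ ρ ∈ Icc ρlo ρhi, knobFlow K M ε ρ T delayInit 1 ≤ -β)
    (hspent : ∀ ρ ∈ Icc ρlo ρhi, knobFlow K M ε ρ T delayInit 2 ≤ lam₀ * ρ ^ 2)
    (hquiet : ∀ ρ ∈ Icc ρlo ρhi, knobFlow K M ε ρ s₀ delayInit 4 ≤ θ₀) :
    (∀ ρ ∈ Icc ρlo ρhi, 0 < knobFlow K M ε ρ T delayInit 3) ∨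
    (∀ ρ ∈ Icc ρlo ρhi, knobFlow K M ε ρ T delayInit 3 < 0) ∨
    ∃ ρ ∈ Icc ρlo ρhi, ∀ t ∈ Icc 0 (T + β / (2 * ε)), knobFlow K M ε ρ t delayInit 4 ^ 2
      ≤ 1 - (exp (-(2 * (2 * ε + K) * (T - s₀))) * (1 - 4 * ε ^ 2 * s₀ ^ 2 - θ₀ ^ 2)
        - 4 * ε * (lam₀ + ε) / (M * β) - 4 * exp (-M) / M) := by
  have hT : 0 ≤ T := hs₀.trans hsT
  -- a member with `d(T) = 0` is a dud
  have hdud : ∀ ρ ∈ Icc ρlo ρhi, knobFlow K M ε ρ T delayInit 3 = 0 →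
      ∀ t ∈ Icc 0 (T + β / (2 * ε)), knobFlow K M ε ρ t delayInit 4 ^ 2
        ≤ 1 - (exp (-(2 * (2 * ε + K) * (T - s₀))) * (1 - 4 * ε ^ 2 * s₀ ^ 2 - θ₀ ^ 2)
          - 4 * ε * (lam₀ + ε) / (M * β) - 4 * exp (-M) / M) := by
    intro ρ hρ hd0 t ht
    obtain ⟨hρ0, hρε⟩ := knob_mem_range hlo hhi hρ
    exact knob_pure_input_dud (hasDerivAt_knobFlow K M ε ρ delayInit) (knobFlow_zero K M ε ρ _)
      hε hε1 hρ0 hρε hM hK hs₀ hsT hβ (hdead ρ hρ) (hspent ρ hρ) (hquiet ρ hρ) hd0 ht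
  -- a zero between two knobs of opposite (weak) signs, by the intermediate value theorem
  have hzero : ∀ ρ₁ ∈ Icc ρlo ρhi, ∀ ρ₂ ∈ Icc ρlo ρhi, knobFlow K M ε ρ₁ T delayInit 3 ≤ 0 →
      0 ≤ knobFlow K M ε ρ₂ T delayInit 3 →
      ∃ ρ ∈ Icc ρlo ρhi, knobFlow K M ε ρ T delayInit 3 = 0 := by
    intro ρ₁ hρ₁ ρ₂ hρ₂ h₁ h₂
    have hθ : (0 : ℝ) ∈ uIcc (knobFlow K M ε ρ₁ T delayInit 3) (knobFlow K M ε ρ₂ T delayInit 3) :=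
      mem_uIcc.2 (Or.inl ⟨h₁, h₂⟩)
    rcases le_total ρ₁ ρ₂ with h12 | h21
    · obtain ⟨ρ, hρ, hz⟩ := knob_phase_selection (hlo.trans_le hρ₁.1) h12 hT 3 hθ
      exact ⟨ρ, ⟨hρ₁.1.trans hρ.1, hρ.2.trans hρ₂.2⟩, hz⟩
    · rw [uIcc_comm] at hθ
      obtain ⟨ρ, hρ, hz⟩ := knob_phase_selection (hlo.trans_le hρ₂.1) h21 hT 3 hθ
      exact ⟨ρ, ⟨hρ₂.1.trans hρ.1, hρ.2.trans hρ₁.2⟩, hz⟩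
  by_cases hpos : ∀ ρ ∈ Icc ρlo ρhi, 0 < knobFlow K M ε ρ T delayInit 3
  · exact Or.inl hpos
  by_cases hneg : ∀ ρ ∈ Icc ρlo ρhi, knobFlow K M ε ρ T delayInit 3 < 0
  · exact Or.inr (Or.inl hneg)
  push Not at hpos hneg
  obtain ⟨ρ₁, hρ₁, h₁⟩ := hpos
  obtain ⟨ρ₂, hρ₂, h₂⟩ := hneg
  obtain ⟨ρ, hρ, hz⟩ := hzero ρ₁ hρ₁ ρ₂ hρ₂ h₁ h₂
  exact Or.inr (Or.inr ⟨ρ, hρ, hdud ρ hρ hz⟩)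

/-! ## §48 Phase lock under robust firing; the dud between opposite signs -/

/-- **PHASE LOCK.** If, in addition to the uniform windows of `knob_lock_or_dud`, EVERY member
fires to deficit `δ` somewhere in the common end-game window `[T, T + β/(2ε)]` and
`2(δ + A(λ₀)) < E₋(θ₀)`, then the transfer mode at clock death has ONE strict sign on the whole
knob range (no member passes through the pure input phase).
[cite: Tao2016AveragedNS, §5.5 Theorem 5.3; HairerNorsettWanner1993, Thm I.10.2] -/
theorem knob_phase_lock {K M ε ρlo ρhi s₀ T β lam₀ θ₀ δ : ℝ} (hε : 0 < ε) (hε1 : ε ≤ 1)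
    (hM : 0 < M) (hK : 0 ≤ K) (hlo : 0 < ρlo) (hhi : ρhi ^ 2 ≤ ε)
    (hs₀ : 0 ≤ s₀) (hsT : s₀ ≤ T) (hβ : 0 < β)
    (hdead : ∀ ρ ∈ Icc ρlo ρhi, knobFlow K M ε ρ T delayInit 1 ≤ -β)
    (hspent : ∀ ρ ∈ Icc ρlo ρhi, knobFlow K M ε ρ T delayInit 2 ≤ lam₀ * ρ ^ 2)
    (hquiet : ∀ ρ ∈ Icc ρlo ρhi, knobFlow K M ε ρ s₀ delayInit 4 ≤ θ₀)
    (hfire : ∀ ρ ∈ Icc ρlo ρhi, ∃ t_f ∈ Icc T (T + β / (2 * ε)),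
      1 - δ ≤ knobFlow K M ε ρ t_f delayInit 4 ^ 2)
    (hm : 2 * (δ + 4 * ε * (lam₀ + ε) / (M * β) + 4 * exp (-M) / M)
      < exp (-(2 * (2 * ε + K) * (T - s₀))) * (1 - 4 * ε ^ 2 * s₀ ^ 2 - θ₀ ^ 2)) :
    (∀ ρ ∈ Icc ρlo ρhi, 0 < knobFlow K M ε ρ T delayInit 3) ∨
    (∀ ρ ∈ Icc ρlo ρhi, knobFlow K M ε ρ T delayInit 3 < 0) := by
  rcases knob_lock_or_dud hε hε1 hM hK hlo hhi hs₀ hsT hβ hdead hspent hquiet with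
    h | h | ⟨ρ, hρ, hdud⟩
  · exact Or.inl h
  · exact Or.inr h
  · exfalso
    obtain ⟨t_f, htf, hf⟩ := hfire ρ hρ
    have hT : 0 ≤ T := hs₀.trans hsT
    have hw : (0 : ℝ) < β / (2 * ε) := by positivity
    have h1 := hdud t_f ⟨hT.trans htf.1, htf.2⟩
    have h2 : knobFlow K M ε ρ t_f delayInit 4 ^ 2 ≤ 1 :=
      RotorKnob.traj_sq_le_one (hasDerivAt_knobFlow K M ε ρ delayInit) (knobFlow_zero K M ε ρ _)
        t_f 4
    have hA : 0 < 4 * ε * (lam₀ + ε) / (M * β) + 4 * exp (-M) / M := by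
      have hl : 0 ≤ lam₀ := by
        have := (hspent ρ hρ).trans' (RotorKnob.c_nonneg (hasDerivAt_knobFlow K M ε ρ delayInit)
          (knobFlow_zero K M ε ρ _) hT)
        obtain ⟨hρ0, -⟩ := knob_mem_range hlo hhi hρ
        nlinarith [pow_pos hρ0 2]
      positivity
    linarith

/-- **THE DUD BETWEEN OPPOSITE SIGNS.** Uniform windows as in `knob_lock_or_dud` and anchors with
`d(T;ρlo)·d(T;ρhi) ≤ 0` ⇒ some member of `[ρlo, ρhi]` is a pure-input-phase dud.
[cite: Tao2016AveragedNS, §5.5 Theorem 5.3; HairerNorsettWanner1993, Thm I.10.2] -/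
theorem knob_dud_between {K M ε ρlo ρhi s₀ T β lam₀ θ₀ : ℝ} (hε : 0 < ε) (hε1 : ε ≤ 1)
    (hM : 0 < M) (hK : 0 ≤ K) (hlo : 0 < ρlo) (hle : ρlo ≤ ρhi) (hhi : ρhi ^ 2 ≤ ε)
    (hs₀ : 0 ≤ s₀) (hsT : s₀ ≤ T) (hβ : 0 < β)
    (hdead : ∀ ρ ∈ Icc ρlo ρhi, knobFlow K M ε ρ T delayInit 1 ≤ -β)
    (hspent : ∀ ρ ∈ Icc ρlo ρhi, knobFlow K M ε ρ T delayInit 2 ≤ lam₀ * ρ ^ 2)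
    (hquiet : ∀ ρ ∈ Icc ρlo ρhi, knobFlow K M ε ρ s₀ delayInit 4 ≤ θ₀)
    (hanchor : knobFlow K M ε ρlo T delayInit 3 * knobFlow K M ε ρhi T delayInit 3 ≤ 0) :
    ∃ ρ ∈ Icc ρlo ρhi, ∀ t ∈ Icc 0 (T + β / (2 * ε)), knobFlow K M ε ρ t delayInit 4 ^ 2
      ≤ 1 - (exp (-(2 * (2 * ε + K) * (T - s₀))) * (1 - 4 * ε ^ 2 * s₀ ^ 2 - θ₀ ^ 2)
        - 4 * ε * (lam₀ + ε) / (M * β) - 4 * exp (-M) / M) := by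
  have hlo' : ρlo ∈ Icc ρlo ρhi := left_mem_Icc.2 hle
  have hhi' : ρhi ∈ Icc ρlo ρhi := right_mem_Icc.2 hle
  rcases knob_lock_or_dud hε hε1 hM hK hlo hhi hs₀ hsT hβ hdead hspent hquiet with
    h | h | h
  · exact absurd hanchor (not_le.2 (mul_pos (h ρlo hlo') (h ρhi hhi')))
  · exact absurd hanchor (not_le.2 (mul_pos_of_neg_of_neg (h ρlo hlo') (h ρhi hhi')))
  · exact h

/-- **THE DUD BETWEEN OPPOSITE DOSE PHASES.** Uniform windows as above; at the two anchor knobs let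
`C` be any primitive of the catalyst and `Φ = (C(T) - C(s₀))/ρ²` the dose phase (part 14). If
`sin Φ·a(s₀)` exceeds `|d(s₀)| + 2(ε + ρ²e^{-M} + Kã(T))(T - s₀)` at one anchor and is below
minus that at the other, some member in between is a pure-input-phase dud.
[cite: Tao2016AveragedNS, §5.5 Theorem 5.3, (5.5); HairerNorsettWanner1993, Thm I.10.2] -/
theorem knob_dud_of_opposite_phases {K M ε ρlo ρhi s₀ T β lam₀ θ₀ : ℝ} {Clo Chi : ℝ → ℝ}
    (hε : 0 < ε) (hε1 : ε ≤ 1) (hM : 0 < M) (hK : 0 ≤ K) (hlo : 0 < ρlo) (hle : ρlo ≤ ρhi)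
    (hhi : ρhi ^ 2 ≤ ε) (hs₀ : 0 ≤ s₀) (hsT : s₀ ≤ T) (hβ : 0 < β)
    (hdead : ∀ ρ ∈ Icc ρlo ρhi, knobFlow K M ε ρ T delayInit 1 ≤ -β)
    (hspent : ∀ ρ ∈ Icc ρlo ρhi, knobFlow K M ε ρ T delayInit 2 ≤ lam₀ * ρ ^ 2)
    (hquiet : ∀ ρ ∈ Icc ρlo ρhi, knobFlow K M ε ρ s₀ delayInit 4 ≤ θ₀)
    (hClo : ∀ t, HasDerivAt Clo (knobFlow K M ε ρlo t delayInit 2) t)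
    (hChi : ∀ t, HasDerivAt Chi (knobFlow K M ε ρhi t delayInit 2) t)
    (hopp : (|knobFlow K M ε ρlo s₀ delayInit 3| + 2 * ((ε + ρlo ^ 2 * exp (-M)
            + K * knobFlow K M ε ρlo T delayInit 4) * (T - s₀))
          < sin ((Clo T - Clo s₀) / ρlo ^ 2) * knobFlow K M ε ρlo s₀ delayInit 0 ∧
        sin ((Chi T - Chi s₀) / ρhi ^ 2) * knobFlow K M ε ρhi s₀ delayInit 0
          < -(|knobFlow K M ε ρhi s₀ delayInit 3| + 2 * ((ε + ρhi ^ 2 * exp (-M)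
            + K * knobFlow K M ε ρhi T delayInit 4) * (T - s₀))))
      ∨ (sin ((Clo T - Clo s₀) / ρlo ^ 2) * knobFlow K M ε ρlo s₀ delayInit 0
          < -(|knobFlow K M ε ρlo s₀ delayInit 3| + 2 * ((ε + ρlo ^ 2 * exp (-M)
            + K * knobFlow K M ε ρlo T delayInit 4) * (T - s₀))) ∧
        |knobFlow K M ε ρhi s₀ delayInit 3| + 2 * ((ε + ρhi ^ 2 * exp (-M)
            + K * knobFlow K M ε ρhi T delayInit 4) * (T - s₀))
          < sin ((Chi T - Chi s₀) / ρhi ^ 2) * knobFlow K M ε ρhi s₀ delayInit 0)) :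
    ∃ ρ ∈ Icc ρlo ρhi, ∀ t ∈ Icc 0 (T + β / (2 * ε)), knobFlow K M ε ρ t delayInit 4 ^ 2
      ≤ 1 - (exp (-(2 * (2 * ε + K) * (T - s₀))) * (1 - 4 * ε ^ 2 * s₀ ^ 2 - θ₀ ^ 2)
        - 4 * ε * (lam₀ + ε) / (M * β) - 4 * exp (-M) / M) := by
  have hXlo := hasDerivAt_knobFlow K M ε ρlo delayInit
  have hXhi := hasDerivAt_knobFlow K M ε ρhi delayInit
  refine knob_dud_between hε hε1 hM hK hlo hle hhi hs₀ hsT hβ hdead hspent hquiet ?_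
  rcases hopp with ⟨h₁, h₂⟩ | ⟨h₁, h₂⟩
  · exact mul_nonpos_iff.2 (Or.inl
      ⟨(knob_transfer_pos hXlo (knobFlow_zero K M ε ρlo _) hClo hε.le hK hs₀ hsT h₁).le,
       (knob_transfer_neg hXhi (knobFlow_zero K M ε ρhi _) hChi hε.le hK hs₀ hsT h₂).le⟩)
  · exact mul_nonpos_iff.2 (Or.inr
      ⟨(knob_transfer_neg hXlo (knobFlow_zero K M ε ρlo _) hClo hε.le hK hs₀ hsT h₁).le,
       (knob_transfer_pos hXhi (knobFlow_zero K M ε ρhi _) hChi hε.le hK hs₀ hsT h₂).le⟩)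

end Summit.NavierStokesRegularity.FluidComputer.GateBudget
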